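import Summits.QuantumFields.BalabanUV.T4Continuum.Support.NE7SliceGreenTorus
import Summits.QuantumFields.BalabanUV.T4Continuum.Support.NE7SliceGreenTestField
import Summits.QuantumFields.BalabanUV.T4Continuum.Support.NE7FramePotL1
import Summits.QuantumFields.BalabanUV.T4Continuum.Support.NE3CpushGaugeCovariance
import HarnessLib

/-!
# NE7SliceGreenFlat — THE SLICE SOLVER LETTER `G♭` OF THE (APE)-BILL AT THE TRIVIAL FLAT DATUM IS A THEOREM, `k`-UNIFORMLY:
# for a skew `(L^{k+1}N)`-periodic TANGENT direction `X` at the flat background whose Hessian source has `(ℓ¹)*`-density `g` on the skew periodic tangent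
# space, `‖curl 1 X (p)‖ ≤ K·L^{k+1}·g` at EVERY plaquette, `K = K(d, L, card n)` INDEPENDENT of `k` and `N`

Cell `pub-balaban`, rung (B)+1 sub-cell t4, lineage `b2b-balaban-t4-ne7-p1`, generation 72 (CRUX PROVER NE7 #1).  File G3b — the assembly of the G♭ discharge:
G1 `NE7SliceGreenTorus.exists_sliceGreen_const` (torus core: lit-balaban's `H_k` curl-orthogonality and kernel decay, B5's Landau gauge `λ₀` and `Δ_1`, GAN24's
`|∇Δ_1⁻¹J| ≤ C(d)|J|`), G2 `NE7FramePotL1.exists_tangent_of_straight_zero` (the corner gauge corrector), G3a `NE7SliceGreenTestField` (the test-direction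
dictionary), F40b `NE7FlatHkOrthogonal.qvOp_entry_coarse_exact` (a T4 tangent direction has entrywise a coarse-exact lit-balaban average), F40a
`curlAt_flat_entry_torus`, F37 `opNorm_le_card_mul`.
WHY.  This is the hypothesis `hG` of F55 `NE7ApeTrivialFlatEndSkew(Budget)` — the LAST displayed Bałaban TYPE of (APE) at the trivial flat datum besides REP♭
(memo H14 §1: «G♭ — [shape] B5 (1.115) ∕ B6 Cor. 2.8 TYPE at `U = 1`»; CURRENCY FACT 1: `K_G = K·M`).  After this file it is a tree theorem with `K` independent
of `k` and `N`; the sequel instantiates F55b with it.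
THE ARGUMENT (entry by entry, `e = (i,i′)`).  Let `x_e(q) = X(rep q)_{ii′}` on the fine torus `T_η` (`η = L^{−(k+1)}`, coarse torus `(N,…,N)`).  (1) F40b: `Q_k x_e`
is a coarse gradient, so `x̃_e := x_e − ∂(g_e ∘ blockOf) ∈ ker Q_k` with the same plaquette field (§2).  (2) For every torus field `a ∈ ker Q_k` and unit scalar
`c`, the test direction `Y^{c·a}_{ii′}` of G3a has vanishing straight `(k+1)`-fold average (`Qcoarse_iterate_test_eq_zero`), so G2 turns it into a skew periodic
TANGENT direction `Y` with the same flat curl and `‖Y‖₁ ≤ C₂‖Y^{c·a}‖₁ ≤ 2C₂·card n·‖a‖₁`; the hypothesis `|hess 1 X Y| ≤ g‖Y‖₁` and G3a's `hess_flat_test` give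
`|Re(c̄·S)| ≤ (card n)²C₂·g·‖a‖₁` for `S = Σ_{p∈perWin} conj(F¹(a))F¹(x_e)` (§1); `c = 1, I` bound `‖S‖`, and lit-balaban's curl pairing
`⟨∂_n a, ∂_n x̃_e⟩ = 2n²S` (`curl_pairing_eq`) is `≤ 4n²(card n)²C₂·g·‖a‖₁` (§3).  (3) G1: every plaquette value of `∂_n x̃_e` is `≤ K₁(d)·4n²(card n)²C₂g`;
`curl 1 X (p)_{ii′} = n⁻¹F_n(x̃_e)(p)` (F40a), and `‖curl 1 X (p)‖ ≤ card n · max_e |entry|` (F37): **`‖curl 1 X (p)‖ ≤ 4K₁(card n)³C₂ · n · g`**, `n = L^{k+1}` (§4).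
WHAT ([folklore]; 0 def, 0 sorry; dimension `d + 1 ≥ 2`, `L ≥ 2`; `C₂ = 1 + 2(d+1)·C_F(d+1,L)` written out).  §1 `abs_re_pairing_le`; §2 `exists_kerQ_entry`;
§3 `norm_curl_pairing_le`; §4 **`sliceGreen_flat`**: `∃ K ≥ 0` (a function of `d`, `L`, `card n`: GAN24's `C(d)`, lit-balaban's decay constants, G2's `C_F`) such
that for ALL `k`, `N ≥ 1`, skew `(L^{k+1}N)`-periodic `X` with `dirIter L (k+1) 1 X = 0`, `g ≥ 0` with the Hessian source bound on skew periodic tangent `Y`, and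
every `z μ ν`: `‖curlAt 1 X z μ ν‖ ≤ K·L^{k+1}·g`.
HONEST FRAMING (page 1): a composition of tree theorems at the FLAT background (`U = 1`, abelian entry by entry); the constant is existential through GAN24's
`C(d)` — not a printed `O(1)`; [B5] (1.115) p. 36 is a TEXT LOCATION, nothing printed is asserted; this is ONE letter of the (APE)-bill at ONE datum (the trivial
one); REP♭ stays a hypothesis of the END; NOT (APE) on the data class, NOT ONE-STEP, NOT NE7; spine 0∕9; finite T⁴ rung (B)+1 — NOT infinite volume, NOT mass gap,
NOT Clay.  Continuum YM on T⁴ ⇐ BetaPertH ∧ nine spine estimates (0/9 proved); BetaPertH ⇐ (D1) ∧ (D4) ∧ CAP+tail; G-an2-4 gates asym, D1 and NE2/3/4.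
-/

set_option autoImplicit false

open scoped BigOperators Matrix ComplexConjugate Matrix.Norms.L2Operator
open Finset

namespace Summit.QuantumFields.BalabanUV.T4Continuum.NE7SliceGreenFlat

open Literature.MathematicalPhysics.QuantumFieldTheory.Balaban1983to89
open B7Prop1Explicit (Site e e_apply)
open T4AveragingDeficitWall (curlAt curl IsSkewDir SmallField dirL1)
open T4AveragingDeficitWallBoundary (periodBox)
open AveragingDeficitPeriodicCounting (IsPeriodicDir)
open B5Prop11Plancherel (Tor fine unitVec)
open B5Action121 (Fs Fs_apply GradOp GradOp_mulVec sdiff_mulVec CurlOp CurlOp_mulVec)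
open B5Block118 (QvOp)
open B5Blocks16 (blockOf QsOp_blockConst)
open B5Hk160Torus (QvOp_GradOp_mulVec)
open B6LowerBound2153Torus (toT rep toT_rep)
open BlockAveragePushDirSplit (flat)
open NE3TangentFlatStructure (framePot)
open NE3TangentCovariantTower (dirIter)
open NE3CpushGaugeCovariance (dirIter_succ_eq_cpushIter)
open NE3FlatHessianCurl (smallField_flatCfg_zero)
open NE3TangentFlatPush (flatCfg_eq_flat)
open NE3HessForm (hess)
open MinimalActionLevels (perWin)
open NE7ApeFlatSkeleton (hess_flat)
open NE7FlatHkOrthogonal (Fs_eq_mul_Fs_one qvOp_entry_coarse_exact)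
open NE7FlatHkCurlLetter (opNorm_le_card_mul)
open NE7TorusBoxDictionary (curlAt_flat_entry_torus)
open NE7SliceGreenTorus (exists_sliceGreen_const)
open NE7FramePotL1 (exists_tangent_of_straight_zero)
open NE7SliceGreenTestField (Fs_one_smul isSkewDir_test isPeriodicDir_test dirL1_test_le Qcoarse_iterate_test_eq_zero hess_flat_test curl_pairing_eq)

noncomputable section

variable {d : ℕ} {n : Type*} [Fintype n] [DecidableEq n]

/-! ## §1 The real part of the twisted entry pairing against a `ker Q_k` test field is bounded by the Hessian source density -/

/-- **`|Re(c̄·S)| ≤ (card n)²·C₂·g·‖a‖₁`** for `S = Σ_{p∈perWin} conj(F¹(a)(p))·F¹(x_{ii′})(p)`, every `a ∈ ker Q_k` and unit scalar `c` (`x_{ii′}` the `(i,i′)` entry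
of the skew periodic `X` whose Hessian source has density `g` on skew periodic tangent directions): G3a's test direction `Y^{c·a}_{ii′}`, G2's corrector, the
hypothesis, G3a's `hess_flat_test` and `dirL1_test_le`. [folklore] -/
theorem abs_re_pairing_le [Nonempty n] (hd2 : 2 ≤ d + 1) {L : ℕ} (hL : 2 ≤ L) (k N : ℕ) [NeZero N] [NeZero (L ^ (k + 1))] [NeZero (L ^ (k + 1) * N)]
    {X : Site (d + 1) → Fin (d + 1) → Matrix n n ℂ} (hXs : IsSkewDir X) (hXP : IsPeriodicDir X ((L ^ (k + 1) * N : ℕ) : ℤ)) {g : ℝ} (hg0 : 0 ≤ g)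
    (hsrc : ∀ Y : Site (d + 1) → Fin (d + 1) → Matrix n n ℂ, IsSkewDir Y → IsPeriodicDir Y ((L ^ (k + 1) * N : ℕ) : ℤ) →
      dirIter L (k + 1) (flat (d := d + 1) (n := n)) Y = 0 →
      |hess (flat (d := d + 1) (n := n)) X Y (perWin (d + 1) (L ^ (k + 1) * N))| ≤ g * dirL1 Y (periodBox (d := d + 1) (L ^ (k + 1) * N)))
    (a : Tor (fine (L ^ (k + 1)) (fun _ : Fin (d + 1) => N)) × Fin (d + 1) → ℂ) (ha : QvOp (L ^ (k + 1)) (fun _ : Fin (d + 1) => N) *ᵥ a = 0)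
    (c : ℂ) (hc : ‖c‖ = 1) (i i' : n) :
    |(conj c * ∑ p ∈ perWin (d + 1) (L ^ (k + 1) * N),
        conj (Fs (fun _ : Fin (d + 1) => L ^ (k + 1) * N) 1 a p.2.1.1 p.2.1.2 (toT (fun _ : Fin (d + 1) => L ^ (k + 1) * N) p.1))
          * Fs (fun _ : Fin (d + 1) => L ^ (k + 1) * N) 1
              (fun q : Tor (fun _ : Fin (d + 1) => L ^ (k + 1) * N) × Fin (d + 1) => X (rep (fun _ : Fin (d + 1) => L ^ (k + 1) * N) q.1) q.2 i i')
              p.2.1.1 p.2.1.2 (toT (fun _ : Fin (d + 1) => L ^ (k + 1) * N) p.1)).re|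
      ≤ (Fintype.card n : ℝ) ^ 2 * (1 + 2 * ((d + 1 : ℕ) : ℝ) * (2 * (((d + 1 : ℕ) : ℝ) * L) * ((2 * ((d + 1) * L) + 1 : ℕ) : ℝ) ^ (d + 1)))
          * g * ∑ j, ‖a j‖ := by
  have hL1 : 1 ≤ L := by omega
  have hN1 : 1 ≤ N := Nat.one_le_iff_ne_zero.mpr (NeZero.ne N)
  have hflat0 : SmallField (flat (d := d + 1) (n := n)) 0 := by rw [← flatCfg_eq_flat]; exact smallField_flatCfg_zero
  have hC₂0 : 0 ≤ 1 + 2 * ((d + 1 : ℕ) : ℝ) * (2 * (((d + 1 : ℕ) : ℝ) * L) * ((2 * ((d + 1) * L) + 1 : ℕ) : ℝ) ^ (d + 1)) := by positivity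
  have hca : QvOp (L ^ (k + 1)) (fun _ : Fin (d + 1) => N) *ᵥ (c • a) = 0 := by rw [Matrix.mulVec_smul, ha, smul_zero]
  -- the test direction of `c·a` and its tangent correction
  have hY₁s := isSkewDir_test (fine (L ^ (k + 1)) (fun _ : Fin (d + 1) => N)) (c • a) i i'
  have hY₁P : IsPeriodicDir (fun (x : Site (d + 1)) (κ : Fin (d + 1)) =>
      Matrix.single i i' ((c • a) (toT (fine (L ^ (k + 1)) (fun _ : Fin (d + 1) => N)) x, κ))
        - Matrix.single i' i (star ((c • a) (toT (fine (L ^ (k + 1)) (fun _ : Fin (d + 1) => N)) x, κ)))) ((L ^ (k + 1) * N : ℕ) : ℤ) :=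
    isPeriodicDir_test (d := d + 1) (L ^ (k + 1) * N) (c • a) i i'
  have hY₁Q := Qcoarse_iterate_test_eq_zero (d := d + 1) L k N (c • a) hca i i'
  obtain ⟨Y, hYs, hYP, hYT, hYcurl, hYl1⟩ := exists_tangent_of_straight_zero (d := d + 1) (n := n) hd2 hL k hN1 hY₁s hY₁P hY₁Q
  -- the hypothesis on `Y`, read on the test direction (same flat curl)
  have hsY : |hess (flat (d := d + 1) (n := n)) X (fun (x : Site (d + 1)) (κ : Fin (d + 1)) =>
      Matrix.single i i' ((c • a) (toT (fine (L ^ (k + 1)) (fun _ : Fin (d + 1) => N)) x, κ))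
        - Matrix.single i' i (star ((c • a) (toT (fine (L ^ (k + 1)) (fun _ : Fin (d + 1) => N)) x, κ)))) (perWin (d + 1) (L ^ (k + 1) * N))|
      ≤ g * dirL1 Y (periodBox (d := d + 1) (L ^ (k + 1) * N)) := by
    have h := hsrc Y hYs hYP hYT
    rw [hess_flat hflat0] at h ⊢
    rw [Finset.sum_congr rfl fun p _ => by unfold T4AveragingDeficitWall.curl; rw [← hYcurl p.1 p.2.1.1 p.2.1.2]]
    exact h
  -- G3a: the Hessian against the test direction is `(2/card n)·Re(conj c·S)`
  rw [hess_flat_test (d := d + 1) (P := L ^ (k + 1) * N) hXs hXP (c • a) i i'] at hsY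
  have hS : ∑ p ∈ perWin (d + 1) (L ^ (k + 1) * N),
      conj (Fs (fun _ : Fin (d + 1) => L ^ (k + 1) * N) 1 (c • a) p.2.1.1 p.2.1.2 (toT (fun _ : Fin (d + 1) => L ^ (k + 1) * N) p.1))
        * Fs (fun _ : Fin (d + 1) => L ^ (k + 1) * N) 1
            (fun q : Tor (fun _ : Fin (d + 1) => L ^ (k + 1) * N) × Fin (d + 1) => X (rep (fun _ : Fin (d + 1) => L ^ (k + 1) * N) q.1) q.2 i i')
            p.2.1.1 p.2.1.2 (toT (fun _ : Fin (d + 1) => L ^ (k + 1) * N) p.1)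
      = conj c * ∑ p ∈ perWin (d + 1) (L ^ (k + 1) * N),
        conj (Fs (fun _ : Fin (d + 1) => L ^ (k + 1) * N) 1 a p.2.1.1 p.2.1.2 (toT (fun _ : Fin (d + 1) => L ^ (k + 1) * N) p.1))
          * Fs (fun _ : Fin (d + 1) => L ^ (k + 1) * N) 1
              (fun q : Tor (fun _ : Fin (d + 1) => L ^ (k + 1) * N) × Fin (d + 1) => X (rep (fun _ : Fin (d + 1) => L ^ (k + 1) * N) q.1) q.2 i i')
              p.2.1.1 p.2.1.2 (toT (fun _ : Fin (d + 1) => L ^ (k + 1) * N) p.1) := by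
    rw [Finset.mul_sum]
    refine Finset.sum_congr rfl fun p _ => ?_
    rw [Fs_one_smul, map_mul, mul_assoc]
  rw [hS] at hsY
  -- the `ℓ¹` size of the test direction
  have hl1 := dirL1_test_le (d := d + 1) (L ^ (k + 1) * N) (c • a) i i'
  have hca1 : ∑ j, ‖(c • a) j‖ = ∑ j, ‖a j‖ := Finset.sum_congr rfl fun j _ => by rw [Pi.smul_apply, norm_smul, hc, one_mul]
  rw [hca1] at hl1
  have hcardpos : (0 : ℝ) < Fintype.card n := by exact_mod_cast Fintype.card_pos
  have key := hsY.trans (mul_le_mul_of_nonneg_left (hYl1.trans (mul_le_mul_of_nonneg_left hl1 hC₂0)) hg0)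
  rw [abs_mul, abs_of_pos (by positivity : (0 : ℝ) < 2 / Fintype.card n)] at key
  refine le_of_mul_le_mul_left (key.trans (le_of_eq ?_)) (by positivity : (0 : ℝ) < 2 / Fintype.card n)
  field_simp

/-! ## §2 The `ker Q_k` representative of an entry of a tangent direction -/

/-- **AN ENTRY OF A T4 TANGENT DIRECTION, GAUGED INTO `ker Q_k`**: for `X` `(L^{k+1}N)`-periodic with `dirIter L (k+1) 1 X = 0`, the torus field
`x̃ = x_{ii′} − ∂(g ∘ blockOf)` (`g = L^{−(k+1)}·framePot L (k+1) X ∘ rep`, F40b `qvOp_entry_coarse_exact`) has `Q_kx̃ = 0` and the plaquette field of `x_{ii′}`. [folklore] -/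
theorem exists_kerQ_entry {L : ℕ} (hL : 1 ≤ L) (k N : ℕ) [NeZero N] [NeZero (L ^ (k + 1))]
    {X : Site (d + 1) → Fin (d + 1) → Matrix n n ℂ} (hXP : IsPeriodicDir X ((L ^ (k + 1) * N : ℕ) : ℤ))
    (hXT : dirIter L (k + 1) (flat (d := d + 1) (n := n)) X = 0) (i i' : n) :
    ∃ xt : Tor (fine (L ^ (k + 1)) (fun _ : Fin (d + 1) => N)) × Fin (d + 1) → ℂ,
      QvOp (L ^ (k + 1)) (fun _ : Fin (d + 1) => N) *ᵥ xt = 0 ∧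
      ∀ (μ ν : Fin (d + 1)) (t : Tor (fine (L ^ (k + 1)) (fun _ : Fin (d + 1) => N))),
        Fs (fine (L ^ (k + 1)) (fun _ : Fin (d + 1) => N)) 1 xt μ ν t
          = Fs (fine (L ^ (k + 1)) (fun _ : Fin (d + 1) => N)) 1
              (fun q : Tor (fine (L ^ (k + 1)) (fun _ : Fin (d + 1) => N)) × Fin (d + 1) =>
                X (rep (fine (L ^ (k + 1)) (fun _ : Fin (d + 1) => N)) q.1) q.2 i i') μ ν t := by
  have hnz : ((L ^ (k + 1) : ℕ) : ℂ) ≠ 0 := by exact_mod_cast NeZero.ne (L ^ (k + 1))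
  have hXT' : ReplicationRightInverse.cpushIter L k (flat (d := d + 1) (n := n)) X = 0 := by rw [← dirIter_succ_eq_cpushIter L k]; exact hXT
  refine ⟨(fun q : Tor (fine (L ^ (k + 1)) (fun _ : Fin (d + 1) => N)) × Fin (d + 1) =>
        X (rep (fine (L ^ (k + 1)) (fun _ : Fin (d + 1) => N)) q.1) q.2 i i')
      - GradOp (fine (L ^ (k + 1)) (fun _ : Fin (d + 1) => N)) ((L ^ (k + 1) : ℕ) : ℂ)
        *ᵥ (fun q => ((L ^ (k + 1) : ℕ) : ℂ)⁻¹ * framePot L (k + 1) X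
            (rep (fun _ : Fin (d + 1) => N) (blockOf (L ^ (k + 1)) (fun _ : Fin (d + 1) => N) q)) i i'), ?_, ?_⟩
  · have h1 : QvOp (L ^ (k + 1)) (fun _ : Fin (d + 1) => N)
        *ᵥ (GradOp (fine (L ^ (k + 1)) (fun _ : Fin (d + 1) => N)) ((L ^ (k + 1) : ℕ) : ℂ)
          *ᵥ (fun q => ((L ^ (k + 1) : ℕ) : ℂ)⁻¹ * framePot L (k + 1) X
              (rep (fun _ : Fin (d + 1) => N) (blockOf (L ^ (k + 1)) (fun _ : Fin (d + 1) => N) q)) i i'))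
        = GradOp (fun _ : Fin (d + 1) => N) 1
          *ᵥ (fun t => ((L ^ (k + 1) : ℕ) : ℂ)⁻¹ * framePot L (k + 1) X (rep (fun _ : Fin (d + 1) => N) t) i i') := by
      rw [QvOp_GradOp_mulVec]
      exact congrArg _ (QsOp_blockConst (L ^ (k + 1)) (fun _ : Fin (d + 1) => N)
        (fun t => ((L ^ (k + 1) : ℕ) : ℂ)⁻¹ * framePot L (k + 1) X (rep (fun _ : Fin (d + 1) => N) t) i i'))
    funext p
    obtain ⟨t, κ⟩ := p
    rw [Matrix.mulVec_sub, Pi.sub_apply, h1, qvOp_entry_coarse_exact hL k hXP hXT' i i' t κ, GradOp_mulVec, sdiff_mulVec, one_mul,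
      Pi.zero_apply, sub_self]
  · intro μ ν t
    rw [Pi.sub_def]
    have hc : ∀ A : Tor (fine (L ^ (k + 1)) (fun _ : Fin (d + 1) => N)) × Fin (d + 1) → ℂ,
        Fs (fine (L ^ (k + 1)) (fun _ : Fin (d + 1) => N)) 1 A μ ν t
          = ((L ^ (k + 1) : ℕ) : ℂ)⁻¹ * Fs (fine (L ^ (k + 1)) (fun _ : Fin (d + 1) => N)) ((L ^ (k + 1) : ℕ) : ℂ) A μ ν t := by
      intro A; rw [Fs_eq_mul_Fs_one _ (((L ^ (k + 1) : ℕ) : ℂ)), ← mul_assoc, inv_mul_cancel₀ hnz, one_mul]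
    rw [hc, hc (fun q => X (rep (fine (L ^ (k + 1)) (fun _ : Fin (d + 1) => N)) q.1) q.2 i i')]
    congr 1
    rw [show ∀ (A B : Tor (fine (L ^ (k + 1)) (fun _ : Fin (d + 1) => N)) × Fin (d + 1) → ℂ), (fun q => A q - B q) = A + (-B) from
      fun A B => by funext q; simp [sub_eq_add_neg], Beta.Ineq167Operator.Fs_add, ← Matrix.mulVec_neg, Beta.Ineq167Operator.Fs_grad, add_zero]

/-! ## §3 The curl pairing of the `ker Q_k` representative against `ker Q_k` -/

/-- **`|⟨∂_n a, ∂_n x̃⟩| ≤ 4n²(card n)²C₂·g·‖a‖₁`** for every `a ∈ ker Q_k`, whenever `x̃` has the plaquette field of the entry `x_{ii′}` of a skew periodic `X` with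
Hessian source density `g` (`n = L^{k+1}`): `⟨∂_n a, ∂_n x̃⟩ = 2n²S` (G3a `curl_pairing_eq`) and `‖S‖ ≤ |Re S| + |Im S|` (§1 at `c = 1, I`). [folklore] -/
theorem norm_curl_pairing_le [Nonempty n] (hd2 : 2 ≤ d + 1) {L : ℕ} (hL : 2 ≤ L) (k N : ℕ) [NeZero N] [NeZero (L ^ (k + 1))] [NeZero (L ^ (k + 1) * N)]
    {X : Site (d + 1) → Fin (d + 1) → Matrix n n ℂ} (hXs : IsSkewDir X) (hXP : IsPeriodicDir X ((L ^ (k + 1) * N : ℕ) : ℤ)) {g : ℝ} (hg0 : 0 ≤ g)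
    (hsrc : ∀ Y : Site (d + 1) → Fin (d + 1) → Matrix n n ℂ, IsSkewDir Y → IsPeriodicDir Y ((L ^ (k + 1) * N : ℕ) : ℤ) →
      dirIter L (k + 1) (flat (d := d + 1) (n := n)) Y = 0 →
      |hess (flat (d := d + 1) (n := n)) X Y (perWin (d + 1) (L ^ (k + 1) * N))| ≤ g * dirL1 Y (periodBox (d := d + 1) (L ^ (k + 1) * N)))
    (i i' : n) (xt : Tor (fine (L ^ (k + 1)) (fun _ : Fin (d + 1) => N)) × Fin (d + 1) → ℂ)
    (hxt : ∀ (μ ν : Fin (d + 1)) (t : Tor (fine (L ^ (k + 1)) (fun _ : Fin (d + 1) => N))),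
      Fs (fine (L ^ (k + 1)) (fun _ : Fin (d + 1) => N)) 1 xt μ ν t
        = Fs (fine (L ^ (k + 1)) (fun _ : Fin (d + 1) => N)) 1
            (fun q : Tor (fine (L ^ (k + 1)) (fun _ : Fin (d + 1) => N)) × Fin (d + 1) =>
              X (rep (fine (L ^ (k + 1)) (fun _ : Fin (d + 1) => N)) q.1) q.2 i i') μ ν t)
    (a : Tor (fine (L ^ (k + 1)) (fun _ : Fin (d + 1) => N)) × Fin (d + 1) → ℂ) (ha : QvOp (L ^ (k + 1)) (fun _ : Fin (d + 1) => N) *ᵥ a = 0) :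
    ‖star (CurlOp (fine (L ^ (k + 1)) (fun _ : Fin (d + 1) => N)) ((L ^ (k + 1) : ℕ) : ℂ) *ᵥ a)
        ⬝ᵥ (CurlOp (fine (L ^ (k + 1)) (fun _ : Fin (d + 1) => N)) ((L ^ (k + 1) : ℕ) : ℂ) *ᵥ xt)‖
      ≤ (4 * ((L ^ (k + 1) : ℕ) : ℝ) ^ 2 * (Fintype.card n : ℝ) ^ 2
            * (1 + 2 * ((d + 1 : ℕ) : ℝ) * (2 * (((d + 1 : ℕ) : ℝ) * L) * ((2 * ((d + 1) * L) + 1 : ℕ) : ℝ) ^ (d + 1))) * g)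
          * ∑ j, ‖a j‖ := by
  -- the pairing is `2n²·S`
  have hp := curl_pairing_eq (d := d + 1) (L ^ (k + 1) * N) (((L ^ (k + 1) : ℕ) : ℂ)) a xt
  rw [Finset.sum_congr rfl fun p _ => by rw [hxt]] at hp
  -- real and imaginary parts
  have hre := abs_re_pairing_le hd2 hL k N hXs hXP hg0 hsrc a ha 1 (by simp) i i'
  rw [map_one, one_mul] at hre
  have him := abs_re_pairing_le hd2 hL k N hXs hXP hg0 hsrc a ha Complex.I (by simp) i i'
  rw [show ∀ S : ℂ, (conj Complex.I * S).re = S.im from fun S => by simp [Complex.conj_I]] at him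
  have hSn := (Complex.norm_le_abs_re_add_abs_im _).trans (add_le_add hre him)
  rw [hp, norm_mul, norm_mul, Complex.norm_ofNat, norm_mul, Complex.norm_conj, Complex.norm_natCast]
  calc 2 * ((((L ^ (k + 1) : ℕ) : ℝ)) * ((L ^ (k + 1) : ℕ) : ℝ)) * _
      ≤ 2 * ((((L ^ (k + 1) : ℕ) : ℝ)) * ((L ^ (k + 1) : ℕ) : ℝ)) * _ := mul_le_mul_of_nonneg_left hSn (by positivity)
    _ = _ := by ring

/-! ## §4 THE END: the slice solver letter at the trivial flat datum -/

/-- **THE SLICE SOLVER LETTER `G♭` AT THE TRIVIAL FLAT DATUM, `k`-UNIFORM** (dimension `d + 1 ≥ 2`, `L ≥ 2`): there is `K ≥ 0`, depending on `d`, `L` and `card n`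
only, such that for every `k`, `N ≥ 1`, every skew `(L^{k+1}N)`-periodic `X` with `dirIter L (k+1) 1 X = 0`, every `g ≥ 0` with
`|hess 1 X Y (perWin)| ≤ g·‖Y‖_{ℓ¹([0,L^{k+1}N)^{d+1})}` for all skew `(L^{k+1}N)`-periodic `Y` with `dirIter L (k+1) 1 Y = 0`, and every `z μ ν`:
`‖curlAt 1 X z μ ν‖ ≤ K·L^{k+1}·g` — the `hG` binder of F55 with `K_G = K·M`. [folklore] -/
theorem sliceGreen_flat [Nonempty n] (hd : 1 ≤ d) {L : ℕ} (hL : 2 ≤ L) :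
    ∃ K : ℝ, 0 ≤ K ∧ ∀ (k N : ℕ) [NeZero N] (X : Site (d + 1) → Fin (d + 1) → Matrix n n ℂ), IsSkewDir X →
      IsPeriodicDir X ((L ^ (k + 1) * N : ℕ) : ℤ) → dirIter L (k + 1) (flat (d := d + 1) (n := n)) X = 0 → ∀ g : ℝ, 0 ≤ g →
      (∀ Y : Site (d + 1) → Fin (d + 1) → Matrix n n ℂ, IsSkewDir Y → IsPeriodicDir Y ((L ^ (k + 1) * N : ℕ) : ℤ) →
        dirIter L (k + 1) (flat (d := d + 1) (n := n)) Y = 0 →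
        |hess (flat (d := d + 1) (n := n)) X Y (perWin (d + 1) (L ^ (k + 1) * N))| ≤ g * dirL1 Y (periodBox (d := d + 1) (L ^ (k + 1) * N))) →
      ∀ (z : Site (d + 1)) (μ ν : Fin (d + 1)), ‖curlAt (flat (d := d + 1) (n := n)) X z μ ν‖ ≤ K * (L : ℝ) ^ (k + 1) * g := by
  obtain ⟨K₁, hK₁, hcore⟩ := exists_sliceGreen_const (d := d)
  have hd2 : 2 ≤ d + 1 := by omega
  have hC₂0 : 0 ≤ 1 + 2 * ((d + 1 : ℕ) : ℝ) * (2 * (((d + 1 : ℕ) : ℝ) * L) * ((2 * ((d + 1) * L) + 1 : ℕ) : ℝ) ^ (d + 1)) := by positivity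
  refine ⟨4 * K₁ * (Fintype.card n : ℝ) ^ 3 * (1 + 2 * ((d + 1 : ℕ) : ℝ) * (2 * (((d + 1 : ℕ) : ℝ) * L) * ((2 * ((d + 1) * L) + 1 : ℕ) : ℝ) ^ (d + 1))),
    by positivity, fun k N _ X hXs hXP hXT g hg0 hsrc z μ ν => ?_⟩
  have hL1 : 1 ≤ L := by omega
  haveI : NeZero (L ^ (k + 1)) := ⟨pow_ne_zero _ (by omega)⟩
  haveI : NeZero (L ^ (k + 1) * N) := ⟨Nat.mul_ne_zero (NeZero.ne _) (NeZero.ne N)⟩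
  have hnz : ((L ^ (k + 1) : ℕ) : ℂ) ≠ 0 := by exact_mod_cast NeZero.ne (L ^ (k + 1))
  have hcast : ((L ^ (k + 1) : ℕ) : ℝ) = (L : ℝ) ^ (k + 1) := by push_cast; ring
  -- the entry bound
  have hentry : ∀ i i' : n, ‖curlAt (flat (d := d + 1) (n := n)) X z μ ν i i'‖
      ≤ 4 * K₁ * (Fintype.card n : ℝ) ^ 2
          * (1 + 2 * ((d + 1 : ℕ) : ℝ) * (2 * (((d + 1 : ℕ) : ℝ) * L) * ((2 * ((d + 1) * L) + 1 : ℕ) : ℝ) ^ (d + 1))) * (L : ℝ) ^ (k + 1) * g := by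
    intro i i'
    obtain ⟨xt, hQ, hFs⟩ := exists_kerQ_entry (n := n) hL1 k N hXP hXT i i'
    have hpair := norm_curl_pairing_le hd2 hL k N hXs hXP hg0 hsrc i i' xt hFs
    have hgT0 : 0 ≤ 4 * ((L ^ (k + 1) : ℕ) : ℝ) ^ 2 * (Fintype.card n : ℝ) ^ 2
        * (1 + 2 * ((d + 1 : ℕ) : ℝ) * (2 * (((d + 1 : ℕ) : ℝ) * L) * ((2 * ((d + 1) * L) + 1 : ℕ) : ℝ) ^ (d + 1))) * g := by positivity
    have hG1 := hcore (L ^ (k + 1)) (fun _ : Fin (d + 1) => N) xt hQ _ hgT0 hpair μ ν (toT (fine (L ^ (k + 1)) (fun _ : Fin (d + 1) => N)) z)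
    -- the entry is `n⁻¹·F_n(x̃)`
    have hent : curlAt (flat (d := d + 1) (n := n)) X z μ ν i i'
        = (((L ^ (k + 1) : ℕ) : ℂ))⁻¹ * Fs (fine (L ^ (k + 1)) (fun _ : Fin (d + 1) => N)) ((L ^ (k + 1) : ℕ) : ℂ) xt μ ν
            (toT (fine (L ^ (k + 1)) (fun _ : Fin (d + 1) => N)) z) := by
      have h1 : curlAt (flat (d := d + 1) (n := n)) X z μ ν i i'
          = Fs (fine (L ^ (k + 1)) (fun _ : Fin (d + 1) => N)) 1
              (fun q : Tor (fine (L ^ (k + 1)) (fun _ : Fin (d + 1) => N)) × Fin (d + 1) =>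
                X (rep (fine (L ^ (k + 1)) (fun _ : Fin (d + 1) => N)) q.1) q.2 i i') μ ν (toT (fine (L ^ (k + 1)) (fun _ : Fin (d + 1) => N)) z) :=
        curlAt_flat_entry_torus (P := L ^ (k + 1) * N) hXP z μ ν i i'
      rw [h1, ← hFs, Fs_eq_mul_Fs_one _ (((L ^ (k + 1) : ℕ) : ℂ)), ← mul_assoc, inv_mul_cancel₀ hnz, one_mul]
    rw [hent, norm_mul, norm_inv, Complex.norm_natCast]
    refine (mul_le_mul_of_nonneg_left hG1 (by positivity)).trans (le_of_eq ?_)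
    rw [← hcast]
    field_simp
  -- the operator norm from the entries
  refine (opNorm_le_card_mul _ hentry).trans (le_of_eq ?_)
  ring

end

end Summit.QuantumFields.BalabanUV.T4Continuum.NE7SliceGreenFlat
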